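/-
Copyright: literature formalisation for the harness. Statements follow the cited text.
-/
import Literature.AlgebraicGeometry.CossartPiltant200819.InseparableClimb2008
import Literature.AlgebraicGeometry.Resolution.MuPTorsorLocalUniformizationFFinite
import Mathlib.FieldTheory.PurelyInseparable.Exponent
import HarnessLib

/-!
# Temkin 2013, Remark 1.3.5 (ii)–(iv): local uniformization of threefolds by a Frobenius tower
of `μ_p`-torsors — Cossart–Piltant I, Thm 2.1 WITHOUT the Galois reduction of Thm 7.2

M. Temkin, *Inseparable local uniformization*, J. Algebra 373 (2013) 65–119 (= arXiv:0804.1554),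
Thm 1.3.2 (`Resolution.Temkin2013`): every valuation of a variety over a field `k` is uniformized
by a finite PURELY INSEPARABLE alteration `L/K`. Remark 1.3.5, VERBATIM (arXiv v3 text, Remark
1.5; the held source text carries the unresolved label "Theorem (insepunif)", which is Thm 1.2 of
the arXiv version = Thm 1.3.2 of the journal version = `Resolution.Temkin2013`, and is rendered
"Theorem 1.3.2" below): "(ii) … Assume that `[k:k^p]` is finite. Then there exists a tower
`K = K_m ⊃ … ⊃ L^{p^n} = K_0` such that each `K_i = K_{i-1}(a_i^{1/p})` is purely inseparable of
degree `p` over `K_{i-1}`. Set `K°_i = K° ∩ K_i`. By (i), `K°_0` is locally uniformized by a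
regular scheme `X_0 = Spec(A_0)` (isomorphic to `Nr_L(X')`) … If we know how to uniformize
valuations on `μ_p`-torsors over regular schemes, then we can uniformize `K°_1`, and proceeding
inductively to `K°_2`, etc., we would uniformize the original `K°`. (iii) Thus, Theorem 1.3.2
implies that local uniformization would follow from local uniformization of hypersurfaces in
`𝔸^{d+1}` given by equations of the form `t^p = f(x_1 … x_d)`. … (iv) For example, Cossart and
Piltant in their proof of local uniformization of threefolds had to study singularities of the
form `t^p + g(x_1,x_2,x_3)^{p-1} t + f(x_1,x_2,x_3) = 0`, which they call Artin-Shreier case for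
`g ≠ 0` and inseparable case for `g = 0`. Moreover, the proof of the Artin-Shreier case required
more work in [CP2]."

PROVED here (kernel-checked bookkeeping, no `sorry`), in the abstract-stage idiom of
`Tower2008` / `BareTower2008` and in dimension three (the only place where `3` enters is through
the two printed LEAVES that are quantified over function fields of transcendence degree three):

* `lu3RankOne_of_temkinTower` — for `k` F-finite of characteristic `p` (`[k : k^p] < ∞`,
  `Resolution.FrobeniusFinite p k`): Prop 8.3 of [CP1] (`PrimeDegreeAscent`, the NON-immediate
  prime steps) + the purely inseparable (`g = 0`) case of the hypothesis of [CP1] Thm 7.2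
  (`PurelyInseparableHypothesis k`, supplied for `k` differentially finite by [CP2]'s Main
  theorem, purely inseparable case: the NAMED FACT `CossartPiltant2009MainInseparable`) +
  Temkin's Thm 1.3.2 ⟹ `LU3RankOne k` (local uniformization of rank-one, residually algebraic
  valuations of threefold function fields over `k`);
* `lu3_of_temkinTower` — adding [CP1] Prop 5.1 (`RankReduction`) and the trivial valuation:
  local uniformization of EVERY `k`-valuation of every `K/k` finitely generated of transcendence
  degree three, for `k` differentially finite and F-finite.

NO use is made of the Galois architecture of [CP1] Thm 7.2 (Cor 6.3 climb to the inertia field,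
Prop 8.3 (2), Lemma 9.4, Prop 9.3, Prop 9.5 — `ReductionToArtinSchreier`), nor of the
Artin–Schreier case `g ≠ 0` of [CP2]: exactly Temkin's remark (iv). In particular the unprinted
`G`-stability step of [CP1] Lemma 9.4 (`GStableUniformizationInertialRankOne`, files
`PrimaryContraction2008` … `ArcDescentCore2008`) is NOT load-bearing for [CP1] Thm 2.1 once
Temkin 2013 is admitted as a leaf.

The tower (Temkin (ii), our rendering). Given `(K, V)` admissible and Temkin's `L ⊇ K` finite
purely inseparable with `V' ∩ K = V`, `V'` uniformizable over `k`: let `q = p^n ≥` the exponent of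
`L/K` and `ψ = F^n : L → K`, `ψ(y) = y^q ∈ K` (`IsPurelyInseparable.iterateFrobenius`). We let `L`
act on a COPY `K♯ = FrobeniusTwist p n K` of `K` through `ψ`, and `k` act on `K♯` through
`c ↦ c^q`; then `k → L → K♯` is a scalar tower, `K♯/L` is finite (this is where `[k:k^p] < ∞` is
used) and purely inseparable, and `V`, viewed in `K♯`, restricts along `ψ` to `V'`. The purely
inseparable climb (`hasLU_of_isPurelyInseparable`: strong induction on `[K♯ : L]`, one `μ_p`-step
`K_{i-1} ⊂ K_{i-1}(a^{1/p})` at a time — non-immediate steps by Prop 8.3, immediate ones by the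
`g = 0` hypothesis fed with the rescaled generator `θ' = t b η`, `θ'^p ∈ A ∩ m_V`, of
`GaloisTower2008.admitsASGenerator_of_pthRoot`) transports local uniformizability from `(L, V')`
to `(K♯, V)` over the TWISTED ground field `k^q ⊆ K`; finally, exactly as at the end of
`Resolution.isLocallyUniformizable_of_muPTorsorStepsAt_ffinite`, the identity `K♯ ≃ K` is
semilinear over the Frobenius isomorphism `σ : k ≅ k^q ⊆ K` of ground fields
(`Resolution.IsLocallyUniformizable.of_ringEquiv₂`, `Resolution.baseFrobImageEquiv`), and
`Resolution.IsLocallyUniformizable.of_subfield_base` (a regular local ring is normal, hence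
contains `k ⊇ k^q`, integral, `k ⊆ V`) returns from the ground field `k^q` to `k`. Temkin's (i)
(normalization, `Nr_L(X')`) is thereby bypassed: the regular local ring itself is transported
along `F^n`.

Relation to `Resolution/MuPTorsorLocalUniformizationFFinite.lean`. That file formalises Rem.
1.3.5 (ii) over F-finite `k` for ARBITRARY `K/k` (the theorem
`Resolution.isLocallyUniformizable_of_muPTorsorStepsAt_ffinite`), consuming Temkin's torsor
hypothesis in the form `MuPTorsorStepsAt p k^{p^n} O`: local uniformization ascends along EVERY step `K₀ ⊆ K₀(a^{1/p})` between intermediate fields `K₀` of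
`K/k^{p^n}`, with no side condition on `K₀` or on `O ∩ K₀` (`Resolution.muPTorsor_tower_at`). The
two dimension-three leaves used here ([CP1] Prop 8.3 and the `g = 0` hypothesis) are quantified
over ADMISSIBLE stages only — function fields of transcendence degree three with a rank-one,
residually algebraic valuation (`VState.Adm`) — and therefore do NOT supply `MuPTorsorStepsAt`,
which also asks for the steps between intermediate fields of smaller transcendence degree, where
`O ∩ K₀` need be neither rank one nor residually algebraic. So the climb is redone carrying
admissibility (`hasLU_of_isPurelyInseparable`, via `VState.Adm.up`), and this is the reason for
the twisted copy `K♯`: with the HONEST ground field `k` acting on `K♯`, every stage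
`k → L → K_i → K♯` inherits admissibility over `k`, and the two leaves (stated over `k`) apply
verbatim — no transport of finite generation, transcendence degree, rank or residue field along
`k ≅ k^{p^n}` is needed, as a climb inside `K` over the subfield `k^{p^n}` would require. Shared
with that file (not re-proved): the F-finiteness notion `Resolution.FrobeniusFinite` and
`FrobeniusFinite.iterate`, the two-ground-field transport `IsLocallyUniformizable.of_ringEquiv₂`
(and `of_ringEquiv` for the trivial step of the climb), `baseFrobImage(Equiv)`, and the
ground-field enlargement `IsLocallyUniformizable.of_subfield_base`.

Hypothesis `[k : k^p] < ∞` (`Resolution.FrobeniusFinite p k`: `k = k^p(s)` for a finite `s`).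
[CP1]/[CP2] assume `k` differentially finite over a perfect subfield `k₀`
(`IsDifferentiallyFinite k`), which implies `[k : k^p] < ∞` (Matsumura, Commutative Ring Theory,
§26, Thm 26.5 on `p`-bases and differential bases; Cossart–Piltant, *Resolution of singularities
of arithmetical threefolds II*, arXiv:1412.0868, Introduction p. 3, summarise the hypothesis of
[CP1]/[CP2] as "fields `k` with `[k:k^p]<+∞` [CoP1] [CoP2]"); that implication is field theory
not formalised here, so the headline theorems carry BOTH hypotheses (`IsDifferentiallyFinite k`
feeds [CP2]; `FrobeniusFinite p k`, through `FrobeniusFinite.iterate`, feeds the finiteness of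
the tower). For `k` perfect, `FrobeniusFinite p k` is `Resolution.FrobeniusFinite.of_perfectRing`.

NOT summit progress: bookkeeping over four NAMED published statements. Tag `b2b`.
[cite: Temkin2013, Rem. 1.3.5 (ii)–(iv) and Thm. 1.3.2]
[cite: CossartPiltant2008, Prop 8.3, Prop 5.1, Thm 7.2 (HAL pp. 19–21)]
[cite: CossartPiltant2009, Main theorem (pp. 1839–1840), purely inseparable case]
-/

namespace Literature.AlgebraicGeometry.CossartPiltant200819.CP2008

open Literature.AlgebraicGeometry.Resolution IsLocalRing Polynomial
open Literature.FieldTheory.ArtinSchreier (rescaled_pthRoot_generator)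
open scoped Pointwise IntermediateField

universe u

/-! ### The purely inseparable (`g = 0`) case of the hypothesis of [CP1] Thm 7.2 -/

/-- **The hypothesis of [CP1] Thm 7.2 in the purely inseparable case `g = 0`** — VERBATIM as
`ArtinSchreierHypothesis k` (HAL pp. 19–20) with `g := 0`, i.e. `h = X^p + f`, `f ∈ m_R`, and
WITHOUT the clause "(with `g ≠ 0` if `k` is perfect)": "for every function field `K` of
transcendence degree three over `k`, for every `k`-valuation ring `V/k` of rank one such that
`κ(V)/k` is algebraic and `QF(V) = K`, and for every local uniformization `R` of `V/k` … for
`f ∈ m_R` such that (1) `h := X^p + f ∈ R[X]` is irreducible over `K`, and (2) there exists a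
unique extension `W` of `V` to `L := QF(S)`, `S := (R[X]/(h))_{(m_R,X)}`, and `V ⊂ W` is immediate,
there exists a local uniformization of `W/k`." This is Temkin's "uniformize valuations on
`μ_p`-torsors over regular schemes" (Rem. 1.3.5 (ii)) restricted to the immediate case — the
non-immediate `μ_p`-torsors being [CP1] Prop 8.3. The polynomial is kept in the tree's normal form
`X^p − 0^{p−1}·X + f`. [cite: CossartPiltant2008, Thm 7.2 hypothesis with g = 0 (HAL pp. 19–20)] -/
def PurelyInseparableHypothesis (k : Type u) [Field k] : Prop :=
  ∀ (p : ℕ), p.Prime → CharP k p →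
  ∀ (K : Type u) [Field K] [Algebra k K], (⊤ : IntermediateField k K).FG → Algebra.trdeg k K = 3 →
  ∀ (O : ValuationSubring K) (hk : ∀ c : k, algebraMap k K c ∈ O), Nonempty O.valuation.RankOne →
    residueTrdeg k O hk = 0 →
  ∀ (R : Subalgebra k K), IsLocalUniformizationOf k K O R →
  ∀ (f : K), f ∈ R → O.valuation f < 1 →
    Irreducible (X ^ p - C ((0 : K) ^ (p - 1)) * X + C f : K[X]) →
  ∀ (L : Type u) [Field L] [Algebra K L] [Algebra k L] [IsScalarTower k K L],
    Nonempty (IsAdjoinRoot L (X ^ p - C ((0 : K) ^ (p - 1)) * X + C f : K[X])) →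
  ∀ (W : ValuationSubring L), W.comap (algebraMap K L) = O →
    (∀ W' : ValuationSubring L, W'.comap (algebraMap K L) = O → W' = W) →
    IsImmediate K W → IsLocallyUniformizable k L W

/-- For an IMPERFECT ground field the `g = 0` case is part of `ArtinSchreierHypothesis k` (the
clause "`g ≠ 0` if `k` is perfect" is void). PROVED. [folklore] -/
theorem ArtinSchreierHypothesis.purelyInseparable {k : Type u} [Field k]
    (h : ArtinSchreierHypothesis k) (hkp : ¬ PerfectField k) : PurelyInseparableHypothesis k := by
  intro p hp hchar K _ _ hfg h3 O hk h1 halg R hR f hf hvf hirr L _ _ _ _ hL W hWO huniq himm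
  exact h p hp hchar K hfg h3 O hk h1 halg R hR f 0 hf (zero_mem R) hvf
    (by rw [map_zero]; exact zero_lt_one) (fun hk' => absurd hk' hkp) hirr L hL W hWO huniq himm

/-- **Cossart–Piltant 2009, Main theorem, purely inseparable case** (pp. 1839–1840), VERBATIM:
"Let `k` be a field of positive characteristic which is differentially finite over a perfect field
`k₀` … Let `S` be a regular local ring of dimension three, essentially of finite type over `k` and
such that `K := QF(S)` has transcendance degree 3 over `k`. Let `R̄` be an Artin–Schreier or purely
inseparable singularity of dimension three over `S`" [Definition p. 1839: `h := X^p − g^{p−1}X + f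
∈ S[X]`, `f, g ∈ m_S`, `g ≠ 0` (resp. `f ∈ m_S`, `g = 0`) "We say that … `R̄ := (S[X]/(h))_{(X,u₁,
u₂,u₃)}` … is an Artin–Schreier (resp. a purely inseparable) singularity"]. "Let `K := QF(S)` and
`L := QF(R̄)`. Then, each `k`-valuation `μ` of `L` dominating `R̄` and satisfying properties (i) and
(ii) below has a local uniformization: (i) `μ` has rank one and `κ(μ)/κ(S)` is algebraic; (ii) `μ`
is the unique extension of its restriction to `K`." Rendered, exactly as `CossartPiltant2009Main`
renders the Artin–Schreier reading, as the `g = 0` case of the hypothesis of [CP1] Thm 7.2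
(`PurelyInseparableHypothesis k`, which carries in addition the immediacy of `W/V` — a further
restriction, so this Prop is implied by the printed theorem; no perfectness restriction on `k`
occurs in [CP2]). A NAMED FACT.
[cite: CossartPiltant2009, Main theorem (pp. 1839–1840), purely inseparable case g = 0] -/
def CossartPiltant2009MainInseparable : Prop :=
  ∀ (p : ℕ) [Fact p.Prime] (k : Type u) [Field k] [CharP k p], IsDifferentiallyFinite k →
    PurelyInseparableHypothesis k

/-- For imperfect differentially finite `k`, the purely inseparable case is already covered by
the tree's rendering `CossartPiltant2009Main` of [CP2]. PROVED. [folklore] -/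
theorem purelyInseparableHypothesis_of_cossartPiltant2009Main (cp2 : CossartPiltant2009Main.{u})
    {p : ℕ} [Fact p.Prime] {k : Type u} [Field k] [CharP k p] (hdf : IsDifferentiallyFinite k)
    (hkp : ¬ PerfectField k) : PurelyInseparableHypothesis k :=
  (cp2 p k hdf).purelyInseparable hkp

/-! ### One `μ_p`-step and the purely inseparable climb -/

section Climb

variable {k : Type u} [Field k]

/-- **One `μ_p`-step** (Temkin Rem. 1.3.5 (ii) "if we know how to uniformize valuations on
`μ_p`-torsors over regular schemes, then we can uniformize `K°_1`"; [CP1] HAL p. 20 l. 18–28): for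
`L = K(η)`, `η^p ∈ K`, `[L : K] = p`, an admissible stage `(K, W ∩ K)` and ANY ground field `k` of
characteristic `p` — by the trichotomy `e = p ∨ f = p ∨ immediate` (`PStepTrichotomy2008`), Prop
8.3 in the first two cases and the `g = 0` hypothesis (with the rescaled generator `θ' = t b η`,
`f := −θ'^p ∈ A ∩ m_V`, and uniqueness of `W` from pure inseparability) in the third, local
uniformizability climbs from `(K, W ∩ K)` to `(L, W)`. PROVED.
[cite: Temkin2013, Rem. 1.3.5 (ii); CossartPiltant2008, Thm 7.2 proof (HAL p. 20 l. 18–28)] -/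
theorem hasLU_of_pthRoot (h83 : PrimeDegreeAscent.{u}) (hPI : PurelyInseparableHypothesis k)
    {p : ℕ} (hp : p.Prime) (hchar : CharP k p) {K L : Type u} [Field K] [Algebra k K] [Field L]
    [Algebra K L] [Algebra k L] [IsScalarTower k K L] [FiniteDimensional K L]
    (hdeg : Module.finrank K L = p) {η : L} {b₀ : K} (hη : η ^ p = algebraMap K L b₀)
    (hηtop : K⟮η⟯ = ⊤) (W : ValuationSubring L) (hkW : ∀ c : k, algebraMap k L c ∈ W)
    (O : ValuationSubring K) (hWO : W.comap (algebraMap K L) = O)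
    (hk : ∀ c : k, algebraMap k K c ∈ O) (hadm : VState.Adm ⟨K, O, hk⟩)
    (hLU : IsLocallyUniformizable k K O) : IsLocallyUniformizable k L W := by
  haveI : Fact p.Prime := ⟨hp⟩
  haveI := hchar
  haveI : CharP K p := charP_of_injective_algebraMap (algebraMap k K).injective p
  subst hWO
  obtain ⟨hfg, h3, h1, halg⟩ := hadm
  rcases trichotomy_of_pthRoot hdeg hη hηtop W with himm | hef
  · -- immediate: the `g = 0` hypothesis on a local uniformization `R` of `V`
    obtain ⟨R, hR⟩ := exists_isLocalUniformizationOf _ hLU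
    obtain ⟨A, -, hfrac, hAO, hRset⟩ := hR.1
    obtain ⟨t, htA, ht0, hvt⟩ :=
      exists_mem_ne_zero_valuation_lt_one (W.comap (algebraMap K L)) h1 A hAO
    obtain ⟨a₁, b, hb, hab⟩ := IsFractionRing.div_surjective (A := A) b₀
    have hb0 : (b : K) ≠ 0 := fun h => nonZeroDivisors.ne_zero hb (Subtype.ext h)
    have hc0 : t * b ≠ 0 := mul_ne_zero ht0 hb0
    obtain ⟨-, -, hirr, hL⟩ := rescaled_pthRoot_generator hdeg hη hηtop hc0
    have hf : -((t * (b : K)) ^ p * b₀) = -(t * (t ^ (p - 1) * (b : K) ^ (p - 1) * a₁)) := by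
      rw [← hab]
      exact congrArg Neg.neg (rescale_identity hp.ne_zero t a₁ b hb0)
    have hf₀A : t ^ (p - 1) * (b : K) ^ (p - 1) * a₁ ∈ A :=
      mul_mem (mul_mem (pow_mem htA _) (pow_mem b.2 _)) a₁.2
    have hfR : -((t * (b : K)) ^ p * b₀) ∈ R := by
      rw [hf]
      exact mem_of_mem_model hRset (neg_mem (mul_mem htA hf₀A))
    have hvf : (W.comap (algebraMap K L)).valuation (-((t * (b : K)) ^ p * b₀)) < 1 := by
      rw [hf, Valuation.map_neg]
      exact valuation_mul_lt_one hvt (hAO hf₀A)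
    haveI : IsPurelyInseparable K L := isPurelyInseparable_of_pthRoot hη hηtop
    have huniq : ∀ W' : ValuationSubring L,
        W'.comap (algebraMap K L) = W.comap (algebraMap K L) → W' = W :=
      fun W' hW' => eq_of_comap_eq_of_isPurelyInseparable hW'
    exact hPI p hp hchar K hfg h3 (W.comap (algebraMap K L)) hk h1 halg R hR _ hfR hvf hirr L hL
      W rfl huniq himm
  · -- `e = p` or `f = p`: Prop 8.3
    have h1L : Nonempty W.valuation.RankOne :=
      (VState.Adm.up W hkW ⟨hfg, h3, h1, halg⟩).2.2.1
    exact h83 k K hfg h3 L (hdeg ▸ hp) W hkW h1L hef hLU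

/-- **The purely inseparable climb** (Temkin Rem. 1.3.5 (ii) "proceeding inductively to `K°_2`,
etc."): for `M/K` finite purely inseparable, `(K, W ∩ K)` admissible and uniformizable ⟹ `(M, W)`
uniformizable — along `K ⊂ K(η₁) ⊂ K(η₁)(η₂) ⊂ ⋯`, `ηᵢᵖ` in the previous field, by strong
induction on `[M : K]`. PROVED, for ANY ground field `k` of characteristic `p`.
[cite: Temkin2013, Rem. 1.3.5 (ii); CossartPiltant2008, Thm 7.2 proof (HAL p. 20)] -/
theorem hasLU_of_isPurelyInseparable (h83 : PrimeDegreeAscent.{u})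
    (hPI : PurelyInseparableHypothesis k) (p : ℕ) (hp : p.Prime) (hchar : CharP k p) :
    ∀ (n : ℕ) {K M : Type u} [Field K] [Algebra k K] [Field M] [Algebra K M] [Algebra k M]
      [IsScalarTower k K M] [FiniteDimensional K M] [IsPurelyInseparable K M],
      Module.finrank K M = n → ∀ (W : ValuationSubring M) (hkW : ∀ c : k, algebraMap k M c ∈ W),
      VState.Adm ⟨K, W.comap (algebraMap K M), forall_algebraMap_mem_comap hkW⟩ →
      IsLocallyUniformizable k K (W.comap (algebraMap K M)) → IsLocallyUniformizable k M W := by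
  intro n
  induction n using Nat.strong_induction_on with
  | _ n ih =>
  intro K M _ _ _ _ _ _ _ _ hn W hkW hadm hLU
  haveI : Fact p.Prime := ⟨hp⟩
  haveI := hchar
  haveI : CharP K p := charP_of_injective_algebraMap (algebraMap k K).injective p
  haveI : CharP M p := charP_of_injective_algebraMap (algebraMap k M).injective p
  haveI : ExpChar K p := ExpChar.prime hp
  by_cases h1 : Module.finrank K M = 1
  · -- `K → M` bijective: transport along the `k`-isomorphism (`Resolution.IsLocallyUniformizable.of_ringEquiv`)
    have hb : Function.Bijective (algebraMap K M) := by
      refine ⟨(algebraMap K M).injective, fun m => ?_⟩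
      have hbt : (⊥ : Subalgebra K M) = ⊤ := Subalgebra.bot_eq_top_iff_finrank_eq_one.mpr h1
      have hm : m ∈ (⊥ : Subalgebra K M) := hbt ▸ Algebra.mem_top
      exact Algebra.mem_bot.mp hm
    let e : K ≃+* M := RingEquiv.ofBijective (algebraMap K M) hb
    have he : (e : K →+* M) = algebraMap K M := RingHom.ext fun x => rfl
    refine IsLocallyUniformizable.of_ringEquiv e (RingEquiv.refl k) (fun c => ?_) W ?_
    · show algebraMap K M (algebraMap k K c) = algebraMap k M c
      exact (IsScalarTower.algebraMap_apply k K M c).symm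
    · rw [he]
      exact hLU
  have hbt : (⊥ : IntermediateField K M) ≠ ⊤ := fun h =>
    h1 (IntermediateField.bot_eq_top_iff_finrank_eq_one.mp h)
  obtain ⟨η, hηK, b, hb⟩ := exists_not_mem_bot_pow_eq (K := K) (M := M) p hbt
  -- the simple step `K' = K(η)` of degree `p`
  have hdegK' : Module.finrank K K⟮η⟯ = p := finrank_adjoin_simple_eq_of_pow_eq hp hb hηK
  have hη' : (IntermediateField.AdjoinSimple.gen K η) ^ p = algebraMap K K⟮η⟯ b :=
    Subtype.ext (by simpa using hb)
  haveI : IsScalarTower k K⟮η⟯ M := isScalarTower_intermediateField' (k := k) K⟮η⟯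
  have hkW' : ∀ c : k, algebraMap k K⟮η⟯ c ∈ W.comap (algebraMap K⟮η⟯ M) :=
    forall_algebraMap_mem_comap_intermediateField hkW K⟮η⟯
  have step1 : IsLocallyUniformizable k K⟮η⟯ (W.comap (algebraMap K⟮η⟯ M)) :=
    hasLU_of_pthRoot h83 hPI hp hchar hdegK' hη' (adjoin_simple_gen_eq_top η)
      (W.comap (algebraMap K⟮η⟯ M)) hkW' (W.comap (algebraMap K M))
      (comap_comap_algebraMap K⟮η⟯ W) (forall_algebraMap_mem_comap hkW) hadm hLU
  have hadm' : VState.Adm ⟨K⟮η⟯, W.comap (algebraMap K⟮η⟯ M), hkW'⟩ := by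
    refine VState.Adm.up (K := K) (W.comap (algebraMap K⟮η⟯ M)) hkW' ?_
    rw [VState.mk_congr (comap_comap_algebraMap K⟮η⟯ W) _ (forall_algebraMap_mem_comap hkW)]
    exact hadm
  -- the rest of the climb, by induction (`[M : K(η)] < [M : K]`)
  have hlt : Module.finrank K⟮η⟯ M < n := by
    have hmul := Module.finrank_mul_finrank K K⟮η⟯ M
    rw [hdegK', hn] at hmul
    have hpos : 0 < Module.finrank K⟮η⟯ M := Module.finrank_pos
    have h2 := hp.two_le
    nlinarith
  exact ih _ hlt (K := K⟮η⟯) (M := M) rfl W hkW hadm' step1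

end Climb


/-! ### The Frobenius twist `K♯` of `K` (Temkin Rem. 1.3.5 (ii): "`K ⊃ … ⊃ L^{p^n} = K_0`") -/

/-- A COPY of the field `K`, to be equipped with (1) the `k`-structure twisted by the `n`-th
Frobenius power of `k`, `c ↦ c^{p^n}`, and (2) for `L/K` purely inseparable of exponent `≤ n`,
the `L`-structure `ψ = F^n : L → K`, `ψ(y) = y^{p^n}` (`IsPurelyInseparable.iterateFrobenius`).
With these, `k → L → K♯` is a scalar tower isomorphic (via `F^n`) to `k^{p^n} ⊆ L^{p^n} ⊆ K`. A
type synonym, so that the honest instances of `K` are not found on `K♯`. [folklore] -/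
def FrobeniusTwist (_p _n : ℕ) (K : Type u) : Type u := K

namespace FrobeniusTwist

variable (p n : ℕ) (K : Type u) [Field K]

/-- The field structure of `K`, copied to `K♯`. [folklore] -/
instance instField : Field (FrobeniusTwist p n K) := inferInstanceAs (Field K)

/-- The identity `K ≃+* K♯`. [folklore] -/
def toTwist : K ≃+* FrobeniusTwist p n K := RingEquiv.refl K

/-- `K♯` has the characteristic of `K`. [folklore] -/
instance instCharP [CharP K p] : CharP (FrobeniusTwist p n K) p := inferInstanceAs (CharP K p)

/-- The TWISTED `k`-structure on `K♯`: `c ↦ c^{p^n} ∈ K`. [folklore] -/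
instance instAlgebra {k : Type u} [Field k] [Algebra k K] [ExpChar k p] :
    Algebra k (FrobeniusTwist p n K) :=
  ((toTwist p n K).toRingHom.comp ((algebraMap k K).comp (iterateFrobenius k p n))).toAlgebra

/-- The twisted structure map is `c ↦ c^{p^n}`. [folklore] -/
theorem algebraMap_apply {k : Type u} [Field k] [Algebra k K] [ExpChar k p] (c : k) :
    algebraMap k (FrobeniusTwist p n K) c = toTwist p n K (algebraMap k K (c ^ p ^ n)) := rfl

variable {K}
variable (L : Type u) [Field L] [Algebra K L] [Fact p.Prime] [CharP K p]
  [IsPurelyInseparable.HasExponent K L] [hn : Fact (IsPurelyInseparable.exponent K L ≤ n)]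

/-- The `L`-structure on `K♯` through `ψ = F^n : L → K`, `ψ(y) = y^{p^n} ∈ K`, for `L/K`
purely inseparable of exponent `≤ n`. A scoped instance (`open scoped FrobeniusTwist`); `K♯` is a
`def` synonym, so no library instance is overridden — the only diamond is with `instAlgebra` in
the degenerate case `L = K` (both give `x ↦ x^{p^n}`, not definitionally equal), which is never
instantiated here. [folklore] -/
noncomputable scoped instance algebraTop : Algebra L (FrobeniusTwist p n K) :=
  ((toTwist p n K).toRingHom.comp (IsPurelyInseparable.iterateFrobenius K L p hn.out)).toAlgebra

/-- `ψ(y) = y^{p^n}`, read in `L`. [folklore] -/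
theorem algebraMap_top_apply (y : L) :
    algebraMap K L ((toTwist p n K).symm (algebraMap L (FrobeniusTwist p n K) y)) = y ^ p ^ n :=
  IsPurelyInseparable.algebraMap_iterateFrobenius K p hn.out y

/-- `ψ(x) = x^{p^n}` for `x ∈ K`. [folklore] -/
theorem algebraMap_top_algebraMap (x : K) :
    algebraMap L (FrobeniusTwist p n K) (algebraMap K L x) = toTwist p n K (x ^ p ^ n) := by
  show toTwist p n K (IsPurelyInseparable.iterateFrobenius K L p hn.out (algebraMap K L x)) = _
  rw [IsPurelyInseparable.iterateFrobenius_algebraMap]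

/-- Every `x ∈ K♯` satisfies `x^{p^n} = ψ(x)` with `x` read in `L`. [folklore] -/
theorem pow_eq_algebraMap_top (x : FrobeniusTwist p n K) :
    x ^ p ^ n = algebraMap L (FrobeniusTwist p n K) (algebraMap K L ((toTwist p n K).symm x)) := by
  rw [algebraMap_top_algebraMap]
  rfl

/-- `k → L → K♯` is a scalar tower (`(c^{p^n})` computed either way). [folklore] -/
scoped instance isScalarTower {k : Type u} [Field k] [Algebra k K] [Algebra k L]
    [IsScalarTower k K L] [ExpChar k p] : IsScalarTower k L (FrobeniusTwist p n K) :=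
  IsScalarTower.of_algebraMap_eq fun c => by
    rw [IsScalarTower.algebraMap_apply k K L c, algebraMap_top_algebraMap, ← map_pow]
    rfl

/-- `K♯/L` is purely inseparable (`x^{p^n} = ψ(x)`). [folklore] -/
theorem isPurelyInseparable_top : IsPurelyInseparable L (FrobeniusTwist p n K) := by
  haveI : ExpChar L p := expChar_of_injective_algebraMap (algebraMap K L).injective p
  rw [isPurelyInseparable_iff_pow_mem L p]
  exact fun x => ⟨n, algebraMap K L ((toTwist p n K).symm x), (pow_eq_algebraMap_top p n L x).symm⟩

/-- **`[K♯ : L] < ∞`** — the one place where F-finiteness of `k` is used (Temkin Rem. 1.3.5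
(ii) "Assume that `[k:k^p]` is finite"): if `K = k(T)` with `T` finite and `k = k^{p^n}(B)` with
`B` finite (the conclusion of `Resolution.FrobeniusFinite.iterate`), then `K♯` is generated over
`L` (i.e. over `L^{p^n} ⊇ K^{p^n} ⊇ k^{p^n}`) by the finitely many `p^n`-th roots `T ∪ B`.
PROVED. [folklore] -/
theorem finiteDimensional_top {k : Type u} [Field k] [Algebra k K] [Algebra k L]
    [IsScalarTower k K L] [CharP k p]
    (hF : ∃ B : Finset k, Subfield.closure (Set.range (fun x : k => x ^ p ^ n) ∪ (B : Set k)) = ⊤)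
    (hfg : (⊤ : IntermediateField k K).FG) : FiniteDimensional L (FrobeniusTwist p n K) := by
  classical
  obtain ⟨T, hT⟩ := hfg
  obtain ⟨B, hB⟩ := hF
  let S : Finset (FrobeniusTwist p n K) :=
    T.image (toTwist p n K) ∪ B.image (fun b => toTwist p n K (algebraMap k K b))
  have hint : ∀ x ∈ (S : Set (FrobeniusTwist p n K)), IsIntegral L x := fun x _ => by
    refine IsIntegral.of_pow (pow_pos (Fact.out : p.Prime).pos n) ?_
    rw [pow_eq_algebraMap_top p n L x]
    exact isIntegral_algebraMap
  set F := IntermediateField.adjoin L (S : Set (FrobeniusTwist p n K)) with hFdef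
  have hTF : ∀ t ∈ T, toTwist p n K t ∈ F := fun t ht =>
    IntermediateField.subset_adjoin L _
      (Finset.mem_coe.mpr (Finset.mem_union_left _ (Finset.mem_image_of_mem _ ht)))
  have hBF : ∀ b ∈ B, toTwist p n K (algebraMap k K b) ∈ F := fun b hb =>
    IntermediateField.subset_adjoin L _
      (Finset.mem_coe.mpr (Finset.mem_union_right _
        (Finset.mem_image_of_mem (fun b => toTwist p n K (algebraMap k K b)) hb)))
  -- the preimage of `F` in `K` contains `k` and `T`, hence everything
  let F₀ : Subfield K := F.toSubfield.comap (toTwist p n K).toRingHom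
  have hF₀ : ∀ x : K, x ∈ F₀ ↔ toTwist p n K x ∈ F := fun x => Iff.rfl
  have hTF₀ : (T : Set K) ⊆ F₀ := fun t ht => (hF₀ t).mpr (hTF t (Finset.mem_coe.mp ht))
  -- the preimage of `F` in `k` contains `k^{p^n}` and `B`, hence everything
  have hkF₀ : Set.range (algebraMap k K) ⊆ F₀ := by
    rintro _ ⟨c, rfl⟩
    rw [SetLike.mem_coe, hF₀]
    have hgen : Set.range (fun x : k => x ^ p ^ n) ∪ (B : Set k) ⊆
        (F₀.comap (algebraMap k K) : Set k) := by
      rintro x (⟨y, rfl⟩ | hx)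
      · show toTwist p n K (algebraMap k K (y ^ p ^ n)) ∈ F
        rw [← algebraMap_apply p n K y, IsScalarTower.algebraMap_apply k L (FrobeniusTwist p n K)]
        exact F.algebraMap_mem _
      · exact hBF x (Finset.mem_coe.mp hx)
    have hc : c ∈ F₀.comap (algebraMap k K) := by
      refine Subfield.closure_le.mpr hgen ?_
      rw [hB]
      trivial
    exact hc
  have hall : ∀ x : K, toTwist p n K x ∈ F := fun x => by
    have hx : x ∈ (IntermediateField.adjoin k (T : Set K)).toSubfield := by
      rw [hT]
      trivial
    rw [IntermediateField.adjoin_toSubfield] at hx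
    exact (hF₀ x).mp (Subfield.closure_le.mpr (Set.union_subset hkF₀ hTF₀) hx)
  have htop : F = ⊤ := by
    rw [eq_top_iff]
    intro y _
    have hy := hall ((toTwist p n K).symm y)
    rwa [RingEquiv.apply_symm_apply] at hy
  haveI hfin : FiniteDimensional L F := IntermediateField.finiteDimensional_adjoin hint
  rw [htop] at hfin
  exact IntermediateField.topEquiv.toLinearEquiv.finiteDimensional

end FrobeniusTwist

/-! ### Assembly: Temkin's Remark 1.3.5 (ii)–(iv) in dimension three -/

open FrobeniusTwist in
/-- **Temkin 2013, Rem. 1.3.5 (ii)–(iii) for threefolds — [CP1] Thm 7.2's conclusion WITHOUT its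
Galois reduction.** For `k` of characteristic `p` with `[k : k^{p^n}] < ∞` for all `n`: [CP1]
Prop 8.3 (`PrimeDegreeAscent`) + the `g = 0` case of the hypothesis of [CP1] Thm 7.2
(`PurelyInseparableHypothesis k`) + Temkin's Thm 1.3.2 (`Temkin2013`) ⟹ `LU3RankOne k`. Proof:
Temkin gives `L ⊇ K` finite purely inseparable and `V' ∩ K = V` with `V'` uniformizable over `k`;
`ψ = F^n : L → K♯` (`n` the exponent of `L/K`) makes `K♯ ⊇ ψ(L) ⊇ k^{p^n}` a finite purely
inseparable tower over the twisted ground field, `V♯ ∩ L = V'`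
(`V(y^{p^n}) ≥ 0 ↔ V'(y) ≥ 0`); the purely inseparable climb `hasLU_of_isPurelyInseparable`
carries local uniformizability up to `(K♯, V)` over `k^{p^n}`, and
`Resolution.IsLocallyUniformizable.of_ringEquiv₂` / `of_subfield_base` back to `K` over the
ground field `k` (`k ⊇ k^{p^n}` integral, inside `V`).
No Galois theory, no Cor 6.3 / Lemma 9.4 / Prop 9.3 / Prop 9.5, no Artin–Schreier case `g ≠ 0`.
PROVED. [cite: Temkin2013, Rem. 1.3.5 (ii)–(iii) and Thm. 1.3.2; CossartPiltant2008, Prop 8.3 and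
Thm 7.2 (HAL pp. 19–20)] -/
theorem lu3RankOne_of_temkinTower (h83 : PrimeDegreeAscent.{u}) (hT : Temkin2013.{u})
    {k : Type u} [Field k] {p : ℕ} [Fact p.Prime] [CharP k p]
    (hPI : PurelyInseparableHypothesis k) (hF : FrobeniusFinite p k) : LU3RankOne k := by
  intro K _ _ hfg h3 O hk h1 halg
  have hp : p.Prime := Fact.out
  haveI : CharP K p := charP_of_injective_algebraMap (algebraMap k K).injective p
  obtain ⟨L, _, _, _, _, hfin, hpi, O', hO'O, hLU'⟩ := hT k K hfg O hk
  haveI := hfin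
  haveI := hpi
  subst hO'O
  -- `V'` contains `k`; the stages `(K, V)` and `(L, V')` are admissible
  have hkL : ∀ c : k, algebraMap k L c ∈ O' := fun c => by
    have h := hk c
    rw [ValuationSubring.mem_comap, ← IsScalarTower.algebraMap_apply] at h
    exact h
  have hadmL : VState.Adm ⟨L, O', hkL⟩ := VState.Adm.up (K := K) O' hkL ⟨hfg, h3, h1, halg⟩
  -- the exponent `n` of `L/K`, the twisted copy `K♯` of `K`, and `V` seen in `K♯`
  haveI : Fact (IsPurelyInseparable.exponent K L ≤ IsPurelyInseparable.exponent K L) := ⟨le_rfl⟩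
  set n := IsPurelyInseparable.exponent K L with hndef
  let Oq : ValuationSubring (FrobeniusTwist p n K) :=
    (O'.comap (algebraMap K L)).comap ((toTwist p n K).symm : FrobeniusTwist p n K →+* K)
  have hmemOq : ∀ x : FrobeniusTwist p n K,
      x ∈ Oq ↔ algebraMap K L ((toTwist p n K).symm x) ∈ O' := fun x => Iff.rfl
  have hkOq : ∀ c : k, algebraMap k (FrobeniusTwist p n K) c ∈ Oq := fun c => by
    rw [hmemOq, algebraMap_apply, RingEquiv.symm_apply_apply, ← IsScalarTower.algebraMap_apply,
      map_pow]
    exact pow_mem (hkL c) _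
  -- `V♯ ∩ L = V'` along `ψ`
  have hres : Oq.comap (algebraMap L (FrobeniusTwist p n K)) = O' := by
    ext y
    rw [ValuationSubring.mem_comap, hmemOq, algebraMap_top_apply, ← O'.valuation_le_one_iff,
      ← O'.valuation_le_one_iff, map_pow, pow_le_one_iff (pow_ne_zero n hp.ne_zero)]
  -- the climb over the twisted ground field `k^{p^n}`
  haveI : IsPurelyInseparable L (FrobeniusTwist p n K) := isPurelyInseparable_top p n L
  haveI : FiniteDimensional L (FrobeniusTwist p n K) :=
    finiteDimensional_top p n L (hF.iterate n) hfg
  have hLUq : IsLocallyUniformizable k (FrobeniusTwist p n K) Oq := by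
    refine hasLU_of_isPurelyInseparable h83 hPI p hp inferInstance _ (K := L)
      (M := FrobeniusTwist p n K) rfl Oq hkOq ?_ ?_
    · rw [VState.mk_congr hres _ hkL]
      exact hadmL
    · rw [hres]
      exact hLU'
  -- back to `K` over the subfield `k₀ = k^{p^n} ⊆ K`: the identity `K♯ ≃ K` is semilinear over
  -- `σ = F^n : k ≅ k₀` (`Resolution.IsLocallyUniformizable.of_ringEquiv₂`)
  let k₀ : Subfield K := baseFrobImage p k K n
  let σ : k ≃+* k₀ := baseFrobImageEquiv (p := p) (k := k) (K := K) n
  have hσ : ∀ c : k, ((σ c : k₀) : K) = algebraMap k K c ^ p ^ n := coe_baseFrobImageEquiv n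
  have hLU₀ : IsLocallyUniformizable k₀ K (O'.comap (algebraMap K L)) := by
    refine IsLocallyUniformizable.of_ringEquiv₂ (toTwist p n K).symm σ (fun c => ?_) _ hLUq
    rw [algebraMap_apply, RingEquiv.symm_apply_apply, map_pow]
    exact (hσ c).symm
  -- and from the ground field `k₀ = k^{p^n}` to `k ⊆ V`, integral over `k₀`
  -- (`Resolution.IsLocallyUniformizable.of_subfield_base`: a regular local ring is normal)
  refine IsLocallyUniformizable.of_subfield_base k₀ (fun x hx => ?_) (fun c => ?_) _ hk hLU₀
  · obtain ⟨c, hc⟩ := mem_baseFrobImage.mp hx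
    exact ⟨c ^ p ^ n, by rw [map_pow, hc]⟩
  · refine IsIntegral.of_pow (pow_pos hp.pos n) ?_
    rw [← hσ c]
    exact isIntegral_algebraMap (R := ↥k₀) (A := K) (x := σ c)

/-- **[CP1] Thm 2.1's local uniformization statement from Temkin's tower** (Temkin 2013 Rem. 1.3.5
(iii)–(iv) for `d = 3`): for `k` differentially finite and F-finite (`[k : k^p] < ∞`) of
characteristic `p`, [CP1] Prop 5.1 (`RankReduction`) + Prop 8.3 (`PrimeDegreeAscent`) + Temkin's
Thm 1.3.2 + [CP2]'s Main theorem in the purely inseparable case `g = 0`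
(`CossartPiltant2009MainInseparable`) give local uniformization of EVERY `k`-valuation of every
`K/k` finitely generated of transcendence degree three — rank `> 1` or `κ(V)/k` transcendental by
Prop 5.1, `V` trivial by `isLocallyUniformizable_of_eq_top`, rank one residually algebraic by
`lu3RankOne_of_temkinTower`. The Galois reduction `ReductionToArtinSchreier` (Thm 7.2, with Cor
6.3, Prop 8.3 (2), Lemma 9.4, Prop 9.3, Prop 9.5) and the Artin–Schreier case of [CP2] are NOT
used (compare `Threefolds2008.lu3_of_leaves`). PROVED. [cite: Temkin2013, Rem. 1.3.5 (iii)–(iv);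
CossartPiltant2008, Prop 5.1, Prop 8.3; CossartPiltant2009, Main theorem (purely inseparable case)] -/
theorem lu3_of_temkinTower (p51 : RankReduction.{u}) (h83 : PrimeDegreeAscent.{u})
    (hT : Temkin2013.{u}) (cp2 : CossartPiltant2009MainInseparable.{u}) (p : ℕ) [Fact p.Prime]
    (k : Type u) [Field k] [CharP k p] (hdf : IsDifferentiallyFinite k) (hF : FrobeniusFinite p k)
    (K : Type u) [Field K] [Algebra k K] (hfg : (⊤ : IntermediateField k K).FG)
    (h3 : Algebra.trdeg k K = 3) (O : ValuationSubring K) (hk : ∀ c : k, algebraMap k K c ∈ O) :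
    IsLocallyUniformizable k K O := by
  by_cases halg : residueTrdeg k O hk = 0
  · rcases rank_trichotomy O with hO | h1 | hgt
    · exact isLocallyUniformizable_of_eq_top hfg hO
    · exact lu3RankOne_of_temkinTower h83 hT (cp2 p k hdf) hF K hfg h3 O hk h1 halg
    · exact p51 k K hfg h3 O hk (Or.inl hgt)
  · exact p51 k K hfg h3 O hk (Or.inr halg)

/-- The same for IMPERFECT `k`, with [CP2] in the tree's rendering `CossartPiltant2009Main` (whose
clause "`g ≠ 0` if `k` is perfect" is then void). PROVED. [folklore] -/
theorem lu3_of_temkinTower_of_not_perfectField (p51 : RankReduction.{u})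
    (h83 : PrimeDegreeAscent.{u}) (hT : Temkin2013.{u}) (cp2 : CossartPiltant2009Main.{u})
    (p : ℕ) [Fact p.Prime] (k : Type u) [Field k] [CharP k p] (hdf : IsDifferentiallyFinite k)
    (hkp : ¬ PerfectField k) (hF : FrobeniusFinite p k) (K : Type u) [Field K] [Algebra k K]
    (hfg : (⊤ : IntermediateField k K).FG) (h3 : Algebra.trdeg k K = 3) (O : ValuationSubring K)
    (hk : ∀ c : k, algebraMap k K c ∈ O) : IsLocallyUniformizable k K O := by
  by_cases halg : residueTrdeg k O hk = 0
  · rcases rank_trichotomy O with hO | h1 | hgt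
    · exact isLocallyUniformizable_of_eq_top hfg hO
    · exact lu3RankOne_of_temkinTower h83 hT
        (purelyInseparableHypothesis_of_cossartPiltant2009Main cp2 hdf hkp) hF K hfg h3 O hk h1
        halg
    · exact p51 k K hfg h3 O hk (Or.inl hgt)
  · exact p51 k K hfg h3 O hk (Or.inr halg)

end Literature.AlgebraicGeometry.CossartPiltant200819.CP2008
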